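import Mathlib

/-!
# Kink contacts of the low branch, II: the upstream junction, the kink selection and the
# Painlevé-II scalings of both corners (solo-blind, s46)

Kernel of solo-blind paper §24.28 (2) and of the corner scalings in (2)–(3) (CLAIMS SB-C451, SB-C453,
predictions SB-C457).  Companion file: `SoloBlindKinkLanding` (the downstream landing).

* **Upstream lift-off.** `C²`-matching of `M - A Q` at `ξ = 0` between the dead side (`M = p e^{ξ}`,
  `Q = 0`) and the live side (`M ≡ μ₀`, `Q = κ₃(ξ³/6 + αξ² + βξ + γ)`, `Aκ₃ = -μ₀`) gives three rules
  for four unknowns: the family `Q_t = κ₃(ξ³/6 + tξ²/2 + tξ + (t-1))`, `t = p/μ₀`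
  (`upstream_junction`, `kinkQ`).  Nonnegativity of the corner value forces `t ≥ 1`, and the absence
  of a dead-side crossing of the near root (`t e^{ξ} ≠ 1` for `ξ < 0`; for `t > 1` the crossing sits
  at `ξ* = -log t`, `dead_side_crossing`) forces `t = 1`, the KINK member (`kink_selection`), whose
  outer foot `q = c₁X + c₂X² + c₃X³` has the parameter-free invariants `c₁c₃/c₂² = 2/3`,
  `c₂/(3c₃) = ℓ`, `6c₃ = κ₃` (`kink_foot_outer`, `foot_fit_invariants`).
* **Corners.** Under `ξ = λ s`, `α = ν y` (`hasDerivAt_rescale`, `hasDerivAt_rescale2`: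
  `α''(λs) = (ν/λ²) y''(s)`) the downstream corner equation `ε α'' = K(α² + 2C₂ξ)α` with
  `λ³ = ε/(2C₂K)`, `ν² = ε/(Kλ²)` becomes `y'' = y³ + s y`, and the upstream one
  `ε α'' + (c₁ξ - c₂α²)α = 0` with `λ₀³ = ε/c₁`, `ν₀² = c₁λ₀/c₂` becomes `y'' = y³ - s y`
  (`pII_scaling_downstream`, `pII_downstream_iff`, `pII_scaling_upstream`): both are solved by
  `y = √2 · w_HM(±s)`, the Hastings–McLeod connection of Painlevé II `w'' = 2w³ + zw`.

Everything here is exact algebra / one-variable calculus over `ℝ`; no asymptotics is formalised.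
-/

namespace Summit.AnomalousDissipation.AnomalousDissipation.Theorems

open Real

/-! ## The upstream junction and the kink selection -/

/-- The upstream inner family `Q_t(ξ) = κ₃ (ξ³/6 + tξ²/2 + tξ + (t - 1))`. -/
noncomputable def kinkQ (κ t ξ : ℝ) : ℝ := κ * (ξ ^ 3 / 6 + t * ξ ^ 2 / 2 + t * ξ + (t - 1))

/-- `C²`-matching of `M - AQ` at `ξ = 0` between the dead side (`M = p e^{ξ}`, `Q = 0`: value,
slope and curvature all equal to `p`) and the live side (`M ≡ μ₀`, `Q = κ₃(ξ³/6 + αξ² + βξ + γ)`,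
`Aκ₃ = -μ₀`): three rules, four unknowns — the family `γ = t - 1`, `β = t`, `α = t/2`, `t = p/μ₀`. -/
theorem upstream_junction (μ0 A κ p α β γ : ℝ) (hμ : μ0 ≠ 0) (hκ : A * κ = -μ0)
    (h0 : p = μ0 - A * κ * γ) (h1 : p = -(A * κ * β)) (h2 : p = -(A * κ * (2 * α))) :
    γ = p / μ0 - 1 ∧ β = p / μ0 ∧ α = p / μ0 / 2 := by
  rw [hκ] at h0 h1 h2
  refine ⟨?_, ?_, ?_⟩
  · field_simp; linarith
  · field_simp; linarith
  · field_simp; linarith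

/-- The family written with `t = p/μ₀` is `kinkQ`. -/
theorem kinkQ_of_junction (κ t ξ : ℝ) :
    κ * (ξ ^ 3 / 6 + (t / 2) * ξ ^ 2 + t * ξ + (t - 1)) = kinkQ κ t ξ := by
  unfold kinkQ; ring

/-- Corner value `Q_t(0) = κ₃ (t - 1)`: nonnegativity (`Q = a²`) needs `t ≥ 1` when `κ₃ > 0`. -/
theorem kinkQ_zero (κ t : ℝ) : kinkQ κ t 0 = κ * (t - 1) := by
  unfold kinkQ; ring

/-- The kink member `t = 1`: `Q = κ₃(ξ + ξ²/2 + ξ³/6)`, `M` continuous, `M'` jumping by `-μ₀ = Aκ₃`. -/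
theorem kinkQ_one (κ ξ : ℝ) : kinkQ κ 1 ξ = κ * (ξ + ξ ^ 2 / 2 + ξ ^ 3 / 6) := by
  unfold kinkQ; ring

/-- The kink member is positive on the live side when `κ₃ > 0` (`⇔ bA < 0`, 24.22(3b)). -/
theorem kinkQ_one_pos (κ ξ : ℝ) (hκ : 0 < κ) (hξ : 0 < ξ) : 0 < kinkQ κ 1 ξ := by
  rw [kinkQ_one]
  have : 0 < ξ + ξ ^ 2 / 2 + ξ ^ 3 / 6 := by positivity
  positivity

/-- For `t > 1` the dead-side shear `t μ₀ e^{ξ}` crosses the near root `μ₀` at `ξ* = -log t < 0`. -/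
theorem dead_side_crossing (t : ℝ) (ht : 1 < t) :
    -Real.log t < 0 ∧ t * Real.exp (-Real.log t) = 1 := by
  refine ⟨by linarith [Real.log_pos ht], ?_⟩
  rw [Real.exp_neg, Real.exp_log (by linarith)]
  field_simp

/-- KINK SELECTION: among the members with a nonnegative corner value, the only one whose dead-side
shear never crosses the near root on `ξ < 0` is `t = 1`. -/
theorem kink_selection (κ t : ℝ) (hκ : 0 < κ) (hQ : 0 ≤ kinkQ κ t 0)
    (hno : ∀ ξ : ℝ, ξ < 0 → t * Real.exp ξ ≠ 1) : t = 1 := by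
  rw [kinkQ_zero] at hQ
  have ht : 1 ≤ t := by
    rcases le_or_gt 1 t with h | h
    · exact h
    · have : κ * (t - 1) < 0 := mul_neg_of_pos_of_neg hκ (by linarith)
      linarith
  rcases ht.eq_or_lt with h | h
  · exact h.symm
  · obtain ⟨hneg, hcross⟩ := dead_side_crossing t h
    exact absurd hcross (hno _ hneg)

/-- The kink foot in outer units `X = x - x₀ = ℓξ`: `q = ℓ³ Q₁(X/ℓ) = c₁X + c₂X² + c₃X³` with
`c₁ = κ₃ℓ²`, `c₂ = κ₃ℓ/2`, `c₃ = κ₃/6`. -/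
theorem kink_foot_outer (κ ℓ X : ℝ) (hℓ : ℓ ≠ 0) :
    ℓ ^ 3 * kinkQ κ 1 (X / ℓ) = (κ * ℓ ^ 2) * X + (κ * ℓ / 2) * X ^ 2 + (κ / 6) * X ^ 3 := by
  rw [kinkQ_one]
  field_simp

/-- Parameter-free invariants of the kink-foot fit (SB-C457): `c₁c₃/c₂² = 2/3`, `c₂/(3c₃) = ℓ`,
`6c₃ = κ₃`. -/
theorem foot_fit_invariants (κ ℓ : ℝ) (hκ : κ ≠ 0) (hℓ : ℓ ≠ 0) :
    (κ * ℓ ^ 2) * (κ / 6) / (κ * ℓ / 2) ^ 2 = 2 / 3 ∧ (κ * ℓ / 2) / (3 * (κ / 6)) = ℓ ∧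
      6 * (κ / 6) = κ := by
  refine ⟨?_, ?_, ?_⟩
  · rw [div_eq_iff (by positivity)]; ring
  · rw [div_eq_iff (by positivity)]; ring
  · ring

/-! ## The Painlevé-II scalings of the two corners -/

/-- Rescaling: if `y` has derivative `d` at `s`, then `ξ ↦ ν·y(ξ/λ)` has derivative `(ν/λ)·d` at
`ξ = λ s`.  Applied twice, `α = ν y(·/λ)` has `α''(λs) = (ν/λ²) y''(s)`. -/
theorem hasDerivAt_rescale (y : ℝ → ℝ) (nu lam s d : ℝ) (hlam : lam ≠ 0) (hy : HasDerivAt y d s) :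
    HasDerivAt (fun ξ => nu * y (ξ / lam)) (nu / lam * d) (lam * s) := by
  have h1 : HasDerivAt (fun ξ : ℝ => ξ / lam) (1 / lam) (lam * s) := by
    simpa using (hasDerivAt_id' (lam * s)).div_const lam
  have hs : (fun ξ : ℝ => ξ / lam) (lam * s) = s := by
    simp only; rw [mul_div_cancel_left₀ s hlam]
  have h2 : HasDerivAt y d ((fun ξ : ℝ => ξ / lam) (lam * s)) := by rw [hs]; exact hy
  have h3 := (h2.comp (lam * s) h1).const_mul nu
  have h4 : HasDerivAt (fun ξ => nu * y (ξ / lam)) (nu * (d * (1 / lam))) (lam * s) := h3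
  refine h4.congr_deriv ?_
  field_simp

/-- Second derivative under rescaling: `α''(λ s) = (ν/λ²) y''(s)`. -/
theorem hasDerivAt_rescale2 (y y1 : ℝ → ℝ) (nu lam s y2 : ℝ) (hlam : lam ≠ 0)
    (hy : ∀ r, HasDerivAt y (y1 r) r) (hy1 : HasDerivAt y1 y2 s) :
    HasDerivAt (fun ξ => nu / lam * y1 (ξ / lam)) (nu / lam ^ 2 * y2) (lam * s) ∧
      deriv (fun ξ => nu * y (ξ / lam)) = fun ξ => nu / lam * y1 (ξ / lam) := by
  constructor
  · have h := hasDerivAt_rescale y1 (nu / lam) lam s y2 hlam hy1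
    refine h.congr_deriv ?_
    rw [div_div, ← pow_two]
  · funext ξ
    have h := hasDerivAt_rescale y nu lam (ξ / lam) (y1 (ξ / lam)) hlam (hy _)
    rw [mul_div_cancel₀ ξ hlam] at h
    exact h.deriv

/-- DOWNSTREAM CORNER → PAINLEVÉ II.  With `ε = Kλ²ν²` and `ν² = 2C₂λ` (equivalently
`λ³ = ε/(2C₂K)`, `ν² = ε/(Kλ²)`, see `pII_scales_downstream`), the right side of
`ε α'' = K(α² + 2C₂ξ)α` at `ξ = λs`, `α = νy` equals `(εν/λ²)(y³ + sy)`; since `α''(λs) = (ν/λ²)y''`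
the corner equation is `y'' = y³ + s y`. -/
theorem pII_scaling_downstream (K C2 ε lam nu y s : ℝ)
    (h1 : ε = K * lam ^ 2 * nu ^ 2) (h2 : nu ^ 2 = 2 * C2 * lam) :
    K * ((nu * y) ^ 2 + 2 * C2 * (lam * s)) * (nu * y) * lam ^ 2 = ε * nu * (y ^ 3 + s * y) := by
  linear_combination (-nu * (y ^ 3 + s * y)) * h1 + (-K * lam ^ 2 * nu * s * y) * h2

/-- The downstream corner scales in the paper's form. -/
theorem pII_scales_downstream (K C2 ε lam nu : ℝ) (hK : K ≠ 0) (hC : C2 ≠ 0) (hlam : lam ≠ 0)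
    (h1 : ε = K * lam ^ 2 * nu ^ 2) (h2 : nu ^ 2 = 2 * C2 * lam) :
    lam ^ 3 = ε / (2 * C2 * K) ∧ nu ^ 2 = ε / (K * lam ^ 2) := by
  constructor
  · rw [eq_div_iff (by positivity)]
    linear_combination (-1) * h1 + (-K * lam ^ 2) * h2
  · rw [eq_div_iff (by positivity)]
    linear_combination (-1) * h1

/-- Equivalence form: with `α''(λs)·λ² = ν Y₂` (`Y₂ = y''(s)`, `hasDerivAt_rescale2`) and `εν ≠ 0`,
the corner equation multiplied by `λ²`, `ε ν Y₂ = K(α² + 2C₂ξ)α·λ²`, holds iff `Y₂ = y³ + s y`. -/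
theorem pII_downstream_iff (K C2 ε lam nu y s Y2 : ℝ) (hε : ε ≠ 0) (hnu : nu ≠ 0)
    (h1 : ε = K * lam ^ 2 * nu ^ 2) (h2 : nu ^ 2 = 2 * C2 * lam) :
    ε * (nu * Y2) = K * ((nu * y) ^ 2 + 2 * C2 * (lam * s)) * (nu * y) * lam ^ 2 ↔
      Y2 = y ^ 3 + s * y := by
  have key := pII_scaling_downstream K C2 ε lam nu y s h1 h2
  have hεn : ε * nu ≠ 0 := mul_ne_zero hε hnu
  constructor
  · intro h
    rw [key] at h
    have h' : ε * nu * Y2 = ε * nu * (y ^ 3 + s * y) := by rw [← h]; ring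
    exact mul_left_cancel₀ hεn h'
  · intro h
    rw [h, key]; ring

/-- UPSTREAM CORNER → PAINLEVÉ II (the other sign).  With `ε = c₁λ₀³` and `c₂ν₀² = c₁λ₀`, the right
side of `εα'' = (c₂α² - c₁ξ)α` at `ξ = λ₀s`, `α = ν₀y` equals `(εν₀/λ₀²)(y³ - sy)`: the corner equation
is `y'' = y³ - s y`, solved by `y(s) = √2·w_HM(-s)`. -/
theorem pII_scaling_upstream (c1 c2 ε lam nu y s : ℝ)
    (h1 : ε = c1 * lam ^ 3) (h2 : c2 * nu ^ 2 = c1 * lam) :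
    (c2 * (nu * y) ^ 2 - c1 * (lam * s)) * (nu * y) * lam ^ 2 = ε * nu * (y ^ 3 - s * y) := by
  linear_combination (nu * y ^ 3 * lam ^ 2) * h2 + (-nu * y ^ 3 + nu * s * y) * h1

/-- The upstream corner scales in the paper's form: `λ₀³ = ε/c₁`, `ν₀² = c₁λ₀/c₂`. -/
theorem pII_scales_upstream (c1 c2 ε lam nu : ℝ) (hc1 : c1 ≠ 0) (hc2 : c2 ≠ 0)
    (h1 : ε = c1 * lam ^ 3) (h2 : c2 * nu ^ 2 = c1 * lam) :
    lam ^ 3 = ε / c1 ∧ nu ^ 2 = c1 * lam / c2 := by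
  constructor
  · rw [eq_div_iff hc1]; linear_combination (-1) * h1
  · rw [eq_div_iff hc2]; linear_combination h2

end Summit.AnomalousDissipation.AnomalousDissipation.Theorems
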